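import Summits.MatrixMultiplication.MatrixMultiplication.Theorems.SoloInformedCwTwoBoundaryAlgebras
import HarnessLib

/-!
# The class representatives below `T_{cw,2}` are isomorphic to Nurmiev normal forms (solo-informed, gen 25)

Companion of `SoloInformedCwTwoBoundaryAlgebras` / `SoloInformedCwTwoNormalForms`.  The degenerations of
`P ≅ T_{cw,2}` certified in this series reach the nilpotent classes `N₃, N₅, N₇, N₈, N₉, N₁₀` through the
representatives `L`, `T_{B_{0,3}}`, `M₇`, `T_{ℂ×ℂ[t]/t²}`, `M₉`, `T_{ℂ[t]/t³}`, identified by their graded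
`ad`-rank profiles.  Here the identification is made exact: kernel certificates of order `0` with constant
invertible matrices, in both directions,

  `L^{(231)} ≅ N₃`, `T_{B_{0,3}}^{(132)} ≅ N₅`, `M₇ ≅ N₇`, `T_{ℂ×ℂ[t]/t²} ≅ N₈`, `M₉^{(213)} ≅ N₉`, `T_{ℂ[t]/t³} ≅ N₁₀`,

where `X^{(231)}(a,b,c) = X(c,a,b)` etc. permutes the tensor factors (the orbit closure of the
`S₃`-symmetric `P` is `S₃`-stable, so `P ⊵ X ⇒ P ⊵ X^σ`).  The factor permutations are forced: the
determinantal cubic of the slice pencil distinguishes the factors — e.g. `det L(x) = 96·x₀²x₁` (double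
line + line) in the first factor of `L` but `det N₃(x) = x₀(x₁ - x₀)(x₁ + x₀)` (three concurrent lines) in
the first two factors of `N₃` — which is also why the coordinate searches `L → N₃`, `T_{B_{0,3}} → N₅`,
`M₉ → N₉` with unpermuted factors found nothing.  The isomorphisms were solved exactly: `A ∈ {0,±1}^{3×3}`
matching the pencil cubics, then the Sylvester-type LINEAR system `Bᵀ·(M'_i M'_λ⁻¹) = (N_i N_λ⁻¹)·Bᵀ` for
`B` and `C = M'_λ⁻¹ B⁻ᵀ N_λ`.
-/

noncomputable section

open scoped BigOperators

namespace Summit.MatrixMultiplication.MatrixMultiplication.Theorems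

open Literature.Computability.AlgebraicComplexity
open Literature.Barriers.MatrixMultiplication (PolyDegeneratesTo)

/-! ## Order-`0` certificates -/

/-- `L^{(231)} ≅ N_3`: constant invertible matrices, `(A, B, C)·L^{(231)} = 48·N_3`. -/
theorem nThreeLimit_iso_nurmiev_3_check :
    DegenCert.check 3 3 3 3 3 3 0 48 (fun a b c => nThreeLimitInt c a b) (nurmievInt 3)
      ![![[-1], [-1], []], ![[1], [], []], ![[-1], [-1], [-1]]]
      ![![[-4], [4], []], ![[-3], [3], [3]], ![[-8], [], []]]
      ![![[2], [], []], ![[], [], [-3]], ![[-2], [2], [2]]] = true := by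
  decide +kernel

/-- … and back: `(A⁻¹, B⁻¹, C⁻¹)` rescaled to integers, `= 3·L^{(231)}`. -/
theorem nurmiev_3_iso_nThreeLimit_check :
    DegenCert.check 3 3 3 3 3 3 0 3 (nurmievInt 3) (fun a b c => nThreeLimitInt c a b)
      ![![[], [1], []], ![[-1], [-1], []], ![[1], [], [-1]]]
      ![![[], [], [-3]], ![[6], [], [-3]], ![[-6], [8], []]]
      ![![[3], [], []], ![[3], [2], [3]], ![[], [-2], []]] = true := by
  decide +kernel

/-- `T_{B_{0,3}}^{(132)} ≅ N_5`: constant invertible matrices, `(A, B, C)·T_{B_{0,3}}^{(132)} = 6·N_5`. -/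
theorem unitalIdem_three_iso_nurmiev_5_check :
    DegenCert.check 3 3 3 3 3 3 0 6 (fun a b c => (unitalIdemInt 3) a c b) (nurmievInt 5)
      ![![[-1], [], []], ![[1], [-1], []], ![[-1], [], [-1]]]
      ![![[2], [3], [2]], ![[], [3], []], ![[-1], [], []]]
      ![![[-3], [-3], []], ![[1], [3], []], ![[-6], [-12], [6]]] = true := by
  decide +kernel

/-- … and back: `(A⁻¹, B⁻¹, C⁻¹)` rescaled to integers, `= 6·T_{B_{0,3}}^{(132)}`. -/
theorem nurmiev_5_iso_unitalIdem_three_check :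
    DegenCert.check 3 3 3 3 3 3 0 6 (nurmievInt 5) (fun a b c => (unitalIdemInt 3) a c b)
      ![![[-1], [], []], ![[-1], [-1], []], ![[1], [], [-1]]]
      ![![[], [], [-6]], ![[], [2], []], ![[3], [-3], [6]]]
      ![![[-3], [-3], []], ![[1], [3], []], ![[-1], [3], [1]]] = true := by
  decide +kernel

/-- `M₇ ≅ N_7`: constant invertible matrices, `(A, B, C)·M₇ = 4·N_7`. -/
theorem nSevenLimit_iso_nurmiev_7_check :
    DegenCert.check 3 3 3 3 3 3 0 4 nSevenLimitInt (nurmievInt 7)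
      ![![[-1], [], [-1]], ![[-1], [-1], []], ![[-1], [], []]]
      ![![[-8], [-6], [4]], ![[], [-2], []], ![[1], [], []]]
      ![![[], [-2], []], ![[4], [-2], [2]], ![[1], [], []]] = true := by
  decide +kernel

/-- … and back: `(A⁻¹, B⁻¹, C⁻¹)` rescaled to integers, `= 2·M₇`. -/
theorem nurmiev_7_iso_nSevenLimit_check :
    DegenCert.check 3 3 3 3 3 3 0 2 (nurmievInt 7) nSevenLimitInt
      ![![[], [], [-1]], ![[], [-1], [1]], ![[-1], [], [1]]]
      ![![[], [], [4]], ![[], [-2], []], ![[1], [-3], [8]]]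
      ![![[], [], [2]], ![[-1], [], []], ![[-1], [1], [-4]]] = true := by
  decide +kernel

/-- `T_{ℂ×ℂ[t]/t²} ≅ N_8`: constant invertible matrices, `(A, B, C)·T_{ℂ×ℂ[t]/t²} = 4·N_8`. -/
theorem unitalIdem_zero_iso_nurmiev_8_check :
    DegenCert.check 3 3 3 3 3 3 0 4 (unitalIdemInt 0) (nurmievInt 8)
      ![![[-1], [], []], ![[1], [-1], []], ![[-1], [], [-1]]]
      ![![[-2], [], []], ![[2], [-2], []], ![[1], [], [-2]]]
      ![![[-1], [2], [2]], ![[], [2], []], ![[2], [], []]] = true := by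
  decide +kernel

/-- … and back: `(A⁻¹, B⁻¹, C⁻¹)` rescaled to integers, `= 4·T_{ℂ×ℂ[t]/t²}`. -/
theorem nurmiev_8_iso_unitalIdem_zero_check :
    DegenCert.check 3 3 3 3 3 3 0 4 (nurmievInt 8) (unitalIdemInt 0)
      ![![[-1], [], []], ![[-1], [-1], []], ![[1], [], [-1]]]
      ![![[-2], [], []], ![[-2], [-2], []], ![[-1], [], [-2]]]
      ![![[], [], [2]], ![[], [2], []], ![[2], [-2], [1]]] = true := by
  decide +kernel

/-- `M₉^{(213)} ≅ N_9`: constant invertible matrices, `(A, B, C)·M₉^{(213)} = 32·N_9`. -/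
theorem nNineLimit_iso_nurmiev_9_check :
    DegenCert.check 3 3 3 3 3 3 0 32 (fun a b c => nNineLimitInt b a c) (nurmievInt 9)
      ![![[-1], [-1], [-1]], ![[-1], [1], []], ![[-1], [-1], []]]
      ![![[4], [], []], ![[-1], [-2], []], ![[], [], [-2]]]
      ![![[], [], [8]], ![[-4], [], []], ![[], [1], []]] = true := by
  decide +kernel

/-- … and back: `(A⁻¹, B⁻¹, C⁻¹)` rescaled to integers, `= 4·M₉^{(213)}`. -/
theorem nurmiev_9_iso_nNineLimit_check :
    DegenCert.check 3 3 3 3 3 3 0 4 (nurmievInt 9) (fun a b c => nNineLimitInt b a c)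
      ![![[], [-1], [-1]], ![[], [1], [-1]], ![[-2], [], [2]]]
      ![![[2], [], []], ![[-1], [-4], []], ![[], [], [-4]]]
      ![![[], [-2], []], ![[], [], [8]], ![[1], [], []]] = true := by
  decide +kernel

/-- `T_{ℂ[t]/t³} ≅ N_10`: constant invertible matrices, `(A, B, C)·T_{ℂ[t]/t³} = 1·N_10`. -/
theorem truncPoly_iso_nurmiev_10_check :
    DegenCert.check 3 3 3 3 3 3 0 1 truncPolyInt (nurmievInt 10)
      ![![[-1], [], []], ![[-1], [-1], []], ![[-1], [-1], [-1]]]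
      ![![[1], [], []], ![[1], [1], []], ![[1], [1], [1]]]
      ![![[-1], [2], [-1]], ![[2], [-1], []], ![[-1], [], []]] = true := by
  decide +kernel

/-- … and back: `(A⁻¹, B⁻¹, C⁻¹)` rescaled to integers, `= 1·T_{ℂ[t]/t³}`. -/
theorem nurmiev_10_iso_truncPoly_check :
    DegenCert.check 3 3 3 3 3 3 0 1 (nurmievInt 10) truncPolyInt
      ![![[-1], [], []], ![[1], [-1], []], ![[], [1], [-1]]]
      ![![[1], [], []], ![[-1], [1], []], ![[], [-1], [1]]]
      ![![[], [], [-1]], ![[], [-1], [-2]], ![[-1], [-2], [-3]]] = true := by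
  decide +kernel

/-- **`L^{(231)} ≅ N_3`** over `ℂ` (mutual degenerations of order `0`). -/
theorem nThreeLimit_iso_nurmiev_3 :
    PolyDegeneratesTo (fun a b c => nThreeLimit ℂ c a b) (nurmiev ℂ 3) ∧
      PolyDegeneratesTo (nurmiev ℂ 3) (fun a b c => nThreeLimit ℂ c a b) :=
  ⟨DegenCert.polyDegeneratesTo_of_check ℂ nThreeLimit_iso_nurmiev_3_check
      (isUnit_iff_ne_zero.mpr (by norm_num)),
    DegenCert.polyDegeneratesTo_of_check ℂ nurmiev_3_iso_nThreeLimit_check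
      (isUnit_iff_ne_zero.mpr (by norm_num))⟩

/-- **`T_{B_{0,3}}^{(132)} ≅ N_5`** over `ℂ` (mutual degenerations of order `0`). -/
theorem unitalIdem_three_iso_nurmiev_5 :
    PolyDegeneratesTo (fun a b c => unitalIdem ℂ 3 a c b) (nurmiev ℂ 5) ∧
      PolyDegeneratesTo (nurmiev ℂ 5) (fun a b c => unitalIdem ℂ 3 a c b) :=
  ⟨DegenCert.polyDegeneratesTo_of_check ℂ unitalIdem_three_iso_nurmiev_5_check
      (isUnit_iff_ne_zero.mpr (by norm_num)),
    DegenCert.polyDegeneratesTo_of_check ℂ nurmiev_5_iso_unitalIdem_three_check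
      (isUnit_iff_ne_zero.mpr (by norm_num))⟩

/-- **`M₇ ≅ N_7`** over `ℂ` (mutual degenerations of order `0`). -/
theorem nSevenLimit_iso_nurmiev_7 :
    PolyDegeneratesTo (nSevenLimit ℂ) (nurmiev ℂ 7) ∧
      PolyDegeneratesTo (nurmiev ℂ 7) (nSevenLimit ℂ) :=
  ⟨DegenCert.polyDegeneratesTo_of_check ℂ nSevenLimit_iso_nurmiev_7_check
      (isUnit_iff_ne_zero.mpr (by norm_num)),
    DegenCert.polyDegeneratesTo_of_check ℂ nurmiev_7_iso_nSevenLimit_check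
      (isUnit_iff_ne_zero.mpr (by norm_num))⟩

/-- **`T_{ℂ×ℂ[t]/t²} ≅ N_8`** over `ℂ` (mutual degenerations of order `0`). -/
theorem unitalIdem_zero_iso_nurmiev_8 :
    PolyDegeneratesTo (unitalIdem ℂ 0) (nurmiev ℂ 8) ∧
      PolyDegeneratesTo (nurmiev ℂ 8) (unitalIdem ℂ 0) :=
  ⟨DegenCert.polyDegeneratesTo_of_check ℂ unitalIdem_zero_iso_nurmiev_8_check
      (isUnit_iff_ne_zero.mpr (by norm_num)),
    DegenCert.polyDegeneratesTo_of_check ℂ nurmiev_8_iso_unitalIdem_zero_check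
      (isUnit_iff_ne_zero.mpr (by norm_num))⟩

/-- **`M₉^{(213)} ≅ N_9`** over `ℂ` (mutual degenerations of order `0`). -/
theorem nNineLimit_iso_nurmiev_9 :
    PolyDegeneratesTo (fun a b c => nNineLimit ℂ b a c) (nurmiev ℂ 9) ∧
      PolyDegeneratesTo (nurmiev ℂ 9) (fun a b c => nNineLimit ℂ b a c) :=
  ⟨DegenCert.polyDegeneratesTo_of_check ℂ nNineLimit_iso_nurmiev_9_check
      (isUnit_iff_ne_zero.mpr (by norm_num)),
    DegenCert.polyDegeneratesTo_of_check ℂ nurmiev_9_iso_nNineLimit_check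
      (isUnit_iff_ne_zero.mpr (by norm_num))⟩

/-- **`T_{ℂ[t]/t³} ≅ N_10`** over `ℂ` (mutual degenerations of order `0`). -/
theorem truncPoly_iso_nurmiev_10 :
    PolyDegeneratesTo (truncPoly ℂ) (nurmiev ℂ 10) ∧
      PolyDegeneratesTo (nurmiev ℂ 10) (truncPoly ℂ) :=
  ⟨DegenCert.polyDegeneratesTo_of_check ℂ truncPoly_iso_nurmiev_10_check
      (isUnit_iff_ne_zero.mpr (by norm_num)),
    DegenCert.polyDegeneratesTo_of_check ℂ nurmiev_10_iso_truncPoly_check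
      (isUnit_iff_ne_zero.mpr (by norm_num))⟩

end Summit.MatrixMultiplication.MatrixMultiplication.Theorems

end
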